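import Mathlib
import Summits.ValiantsHypothesis.ValiantsHypothesis.Theorems.FifoMatchingNNNotVPSupportFnCliqueProjection
import Summits.ValiantsHypothesis.ValiantsHypothesis.Theorems.FifoMatchingNNNotVPNfpmCliqueGadget
import HarnessLib

/-!
# Route FifoMatching — crux `NNNotVP` (stmt-ValiantsHypothesis-11615), line `division_split`:
# nest-free perfect-matching existence needs monotone circuits of EXPONENTIAL size

Registered line `Cruxes/NNNotVP/Lines/division_split.lean`; objects `σ` / `NN` / `SuppFn` = the
line's vocabulary (`Theorems/FifoMatchingNNNotVPDivisionSplitDefs.lean`).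

The tree consumes the clique gadget of nest-free perfect-matching (NFPM) existence
(`nfpm_cliqueGadget`: for all large `n` a monotone projection `σ n → E(K_m) ⊕ Bool`, `n ≤ m^{13}`,
making NFPM existence `(⌊√m⌋-1, ⌊√m⌋)`-clique-like) only at QUASI-POLYNOMIAL rate
(`circuitSizeOver_lowerBound_of_cliqueProjection`, `nfpmExists_monotone_circuitSize_lowerBound`:
`> 2^((log₂ n + c)^c)` for every `c`), although the Alon–Boppana bound it rests on
(`cliqueSqrt_monotone_lowerBound`, `≥ 2^{m^{1/8}}` gates) is EXPONENTIAL.  This file extracts the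
exponential rate, in the integer form `n ≤ (log₂ size)^r` used by the division-hardness files of the
line (`…SpreadCofactorOfExpHard`):

* `two_pow_pred_add_lt` — the comparison `2^(2^q - 1) + 2m² < 2^(2^q) ≤ 2^{m^{1/8}}`,
  `q = ⌊⌊log₂ m⌋/8⌋`, for `m ≥ 2^64`;
* `rate_of_log_ge` — the bookkeeping `2^q ≤ ℓ + 1`, `m < 2^(8q+8)`, `n ≤ m^{C₀}` `⟹` `n ≤ ℓ^(16 C₀)`;
* `circuitSizeOver_expLowerBound_of_cliqueProjection` — from a clique gadget with `n ≤ m^{C₀}`: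
  eventually `n ≤ (log₂ (circuitSizeOver monotoneBasis NFPM_n))^(16 C₀)`;
* ★ `nfpmExists_monotone_circuitSize_expLowerBound` — NFPM existence on the ordered arc sets of
  `[2n]` (= SHUFFLE-SQUARE recognition) needs `{∧₂, ∨₂}`-circuits of size `≥ 2^{n^{1/208}}`:
  eventually `n ≤ (log₂ circuitSizeOver)^208`; `…_expLowerBound'` the `∃ r` form.

Honest framing: a sharpening of a landed rung (qp ↦ exp) for use in the exponential classification
of stub B2; stubs Z / B2, the crux `NNNotVP` and `VP ≠ VNP` stay OPEN (NOT proved).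
No definitions, no named facts.
-/

noncomputable section

-- Sub = Summit single-conjunct layout: the duplicated namespace component is mandated by the tree.
set_option linter.dupNamespace false

namespace Summit.ValiantsHypothesis.ValiantsHypothesis.Theorems.FifoMatching.NNNotVP.DivisionSplit

open MvPolynomial Literature.Computability.AlgebraicComplexity
open Literature.Computability.Complexity
open Literature.Computability.Complexity.GateList
open Filter
open scoped NNReal BigOperators Classical

/-! ### Arithmetic of the exponential rate -/

/-- `16 q + 18 ≤ 2^q` for `q ≥ 8`. [folklore] -/
theorem sixteen_mul_add_le_two_pow {q : ℕ} (hq : 8 ≤ q) : 16 * q + 18 ≤ 2 ^ q := by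
  induction q, hq using Nat.le_induction with
  | base => norm_num
  | succ q _ ih => rw [pow_succ]; omega

/-- **The exponential comparison.**  For `m ≥ 2^64` and `q = ⌊⌊log₂ m⌋ / 8⌋`:
`2^(2^q - 1) + 2m² < 2^(2^q)` (in `ℕ`) and `2^(2^q) ≤ 2^{m^{1/8}}` (in `ℝ`, as `(2^q)^8 ≤ m`).
[folklore] -/
theorem two_pow_pred_add_lt (m : ℕ) (hm : 2 ^ 64 ≤ m) :
    2 ^ (2 ^ (Nat.log 2 m / 8) - 1) + 2 * m ^ 2 < 2 ^ (2 ^ (Nat.log 2 m / 8)) ∧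
      ((2 ^ (2 ^ (Nat.log 2 m / 8)) : ℕ) : ℝ) ≤ (2 : ℝ) ^ ((m : ℝ) ^ (1 / 8 : ℝ)) := by
  have hm0 : m ≠ 0 := by have := Nat.one_le_two_pow (n := 64); omega
  set L : ℕ := Nat.log 2 m with hL
  set q : ℕ := L / 8 with hq
  have hLq : L ≤ 8 * q + 7 := by omega
  have hL64 : 64 ≤ L := Nat.le_log_of_pow_le (by norm_num) hm
  have hq8 : 8 ≤ q := by omega
  have hmL : m < 2 ^ (L + 1) := Nat.lt_pow_succ_log_self (by norm_num) m
  constructor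
  · have hm2 : 2 * m ^ 2 < 2 ^ (2 * L + 3) := by
      have h : m ^ 2 < 2 ^ ((L + 1) * 2) := by
        rw [pow_mul]; exact Nat.pow_lt_pow_left hmL (by norm_num)
      have h' : 2 ^ (2 * L + 3) = 2 * 2 ^ ((L + 1) * 2) := by
        rw [show 2 * L + 3 = ((L + 1) * 2) + 1 by ring, pow_succ]; ring
      rw [h']; omega
    have hT : 2 * L + 4 ≤ 2 ^ q := by
      have := sixteen_mul_add_le_two_pow hq8
      omega
    have e2 : 2 ^ (2 * L + 3) ≤ 2 ^ (2 ^ q - 1) := Nat.pow_le_pow_right (by norm_num) (by omega)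
    have e3 : 2 ^ (2 ^ q - 1) * 2 = 2 ^ (2 ^ q) := by
      rw [← pow_succ, Nat.sub_add_cancel Nat.one_le_two_pow]
    omega
  · have h8 : (2 ^ q) ^ 8 ≤ m := by
      rw [← pow_mul]
      exact le_trans (Nat.pow_le_pow_right (by norm_num) (by omega)) (Nat.pow_log_le_self 2 hm0)
    have hroot : ((2 ^ q : ℕ) : ℝ) ≤ (m : ℝ) ^ (1 / 8 : ℝ) := by
      have h8' : (((2 ^ q : ℕ) : ℝ)) ^ (8 : ℕ) ≤ (m : ℝ) := by exact_mod_cast h8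
      calc ((2 ^ q : ℕ) : ℝ) = ((((2 ^ q : ℕ) : ℝ)) ^ (8 : ℕ)) ^ ((8 : ℕ) : ℝ)⁻¹ :=
          (Real.pow_rpow_inv_natCast (Nat.cast_nonneg _) (by norm_num)).symm
        _ ≤ (m : ℝ) ^ ((8 : ℕ) : ℝ)⁻¹ := Real.rpow_le_rpow (by positivity) h8' (by positivity)
        _ = (m : ℝ) ^ (1 / 8 : ℝ) := by norm_num
    calc ((2 ^ (2 ^ q) : ℕ) : ℝ) = (2 : ℝ) ^ (((2 ^ q : ℕ) : ℝ)) := by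
          rw [Real.rpow_natCast]; push_cast; ring
      _ ≤ (2 : ℝ) ^ ((m : ℝ) ^ (1 / 8 : ℝ)) :=
          Real.rpow_le_rpow_of_exponent_le (by norm_num) hroot

/-- **Rate bookkeeping.**  If `2^q ≤ ℓ + 1` with `q ≥ 8`, `m < 2^(8q+8)` and `n ≤ m^{C₀}`, then
`n ≤ ℓ^(16 C₀)` (`m < (2·2^q)^8 ≤ (2(ℓ+1))^8 ≤ (ℓ²)^8`). [folklore] -/
theorem rate_of_log_ge {n m C₀ q ℓ : ℕ} (hq : 8 ≤ q) (hℓ : 2 ^ q ≤ ℓ + 1)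
    (hm : m < 2 ^ (8 * q + 8)) (hn : n ≤ m ^ C₀) : n ≤ ℓ ^ (16 * C₀) := by
  have h256 : 256 ≤ 2 ^ q :=
    calc 256 = 2 ^ 8 := by norm_num
      _ ≤ 2 ^ q := Nat.pow_le_pow_right (by norm_num) hq
  have hℓ3 : 255 ≤ ℓ := by omega
  have h2q : 2 ^ (q + 1) ≤ 2 * (ℓ + 1) := by rw [pow_succ]; omega
  have hm' : m ≤ (2 * (ℓ + 1)) ^ 8 := by
    have h88 : 2 ^ (8 * q + 8) = (2 ^ (q + 1)) ^ 8 := by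
      rw [← pow_mul]; congr 1; ring
    rw [h88] at hm
    exact hm.le.trans (Nat.pow_le_pow_left h2q 8)
  have hsq : 2 * (ℓ + 1) ≤ ℓ ^ 2 := by nlinarith
  have hm16 : m ≤ ℓ ^ 16 :=
    calc m ≤ (2 * (ℓ + 1)) ^ 8 := hm'
      _ ≤ (ℓ ^ 2) ^ 8 := Nat.pow_le_pow_left hsq 8
      _ = ℓ ^ 16 := by rw [← pow_mul]
  calc n ≤ m ^ C₀ := hn
    _ ≤ (ℓ ^ 16) ^ C₀ := Nat.pow_le_pow_left hm16 C₀
    _ = ℓ ^ (16 * C₀) := by rw [← pow_mul]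

/-! ### The exponential lower bound from a clique-like monotone projection -/

/-- **Exponential `circuitSizeOver` lower bound from a clique gadget.**  Suppose that for some `C₀`
and all large `n` there are `m` with `n ≤ m^{C₀}` and a projection `e : σ n → E(K_m) ⊕ Bool` under
which nest-free perfect-matching existence ACCEPTS the clique vector of every `⌊√m⌋`-set and REJECTS
the colouring vector of every `(⌊√m⌋ - 1)`-colouring.  Then eventually
`n ≤ (log₂ (circuitSizeOver monotoneBasis NFPM_n))^(16 C₀)`: every `{∧₂, ∨₂}`-circuit `D` for NFPM
existence projects (`exists_monotoneCircuit_projection`, `+ 2|E(K_m)|` gates) to one for a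
`(⌊√m⌋-1, ⌊√m⌋)`-clique function, of size `≥ 2^{m^{1/8}} ≥ 2^(2^q)` (`q = ⌊⌊log₂ m⌋/8⌋`,
`cliqueSqrt_monotone_lowerBound`), so `|D| > 2^(2^q - 1)`, `log₂ |D| + 1 ≥ 2^q`, and
`n ≤ m^{C₀} < 2^((8q+8) C₀) ≤ (log₂ |D|)^(16 C₀)`.
[cite: AlonBoppana1987, Lemma 3.14] [cite: Jukna2012, Thm. 9.26 (PDF p. 283)] -/
theorem circuitSizeOver_expLowerBound_of_cliqueProjection (C₀ : ℕ)
    (hP : ∃ n₀ : ℕ, ∀ n ≥ n₀, ∃ m : ℕ, n ≤ m ^ C₀ ∧ ∃ e : σ n → KEdge m ⊕ Bool,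
      (∀ Z : Finset (Fin m), Z.card = Nat.sqrt m →
        decide (SuppFn (NN n) (Finset.univ.filter fun a : σ n =>
          Sum.elim (cliqueVec Z) id (e a) = true)) = true) ∧
      (∀ O : Fin m → Fin (Nat.sqrt m - 1),
        decide (SuppFn (NN n) (Finset.univ.filter fun a : σ n =>
          Sum.elim (colorVec O) id (e a) = true)) = false)) :
    ∃ n₀ : ℕ, ∀ n ≥ n₀, n ≤ (Nat.log 2 (circuitSizeOver monotoneBasis
      (fun x : σ n → Bool => decide (SuppFn (NN n) (Finset.univ.filter fun e => x e = true))))) ^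
        (16 * C₀) := by
  obtain ⟨n₀, hn₀⟩ := hP
  obtain ⟨M₀, hM₀⟩ := eventually_atTop.1 cliqueSqrt_monotone_lowerBound
  set M : ℕ := max M₀ (2 ^ 64) with hM
  refine ⟨max (max n₀ 2) (M ^ C₀), fun n hn => ?_⟩
  have hnn₀ : n₀ ≤ n := le_trans (le_max_left _ _) (le_trans (le_max_left _ _) hn)
  have hn2 : 2 ≤ n := le_trans (le_max_right _ _) (le_trans (le_max_left _ _) hn)
  have hnM : M ^ C₀ ≤ n := le_trans (le_max_right _ _) hn
  obtain ⟨m, hnm, e, hacc, hrej⟩ := hn₀ n hnn₀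
  -- `m ≥ M` (if `C₀ = 0` the hypothesis is absurd for `n ≥ 2`)
  have hmM : M ≤ m := by
    by_contra hlt
    push Not at hlt
    rcases Nat.eq_zero_or_pos C₀ with hC | hC
    · subst hC; simp at hnm; omega
    · have : m ^ C₀ < M ^ C₀ := Nat.pow_lt_pow_left hlt (by omega)
      omega
  have hmM₀ : M₀ ≤ m := le_trans (le_max_left _ _) hmM
  have hm64 : 2 ^ 64 ≤ m := le_trans (le_max_right _ _) hmM
  have hm4 : 4 ≤ m := le_trans (by norm_num) hm64
  have hsqrt2 : 2 ≤ Nat.sqrt m := by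
    rw [Nat.le_sqrt]; omega
  obtain ⟨hlt2, hreal2⟩ := two_pow_pred_add_lt m hm64
  set q : ℕ := Nat.log 2 m / 8 with hq
  -- the positive and negative witnesses exist
  obtain ⟨Z, -, hZ⟩ := Finset.exists_subset_card_eq
    (s := (Finset.univ : Finset (Fin m))) (n := Nat.sqrt m) (by simpa using Nat.sqrt_le_self m)
  let O : Fin m → Fin (Nat.sqrt m - 1) := fun _ => ⟨0, by omega⟩
  -- the NFPM function and the projected (clique-like) function
  set F : (σ n → Bool) → Bool :=
    fun x => decide (SuppFn (NN n) (Finset.univ.filter fun e => x e = true)) with hF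
  have hFmono : Monotone F := nfpmExists_monotone n
  -- every monotone circuit for `F` is large
  have hall : ∀ D : Circuit (σ n), D.IsOver monotoneBasis → D.Computes F →
      2 ^ (2 ^ q - 1) + 1 ≤ D.size := by
    intro D hDB hDF
    have htop : D.eval (fun a => Sum.elim (fun _ : KEdge m => true) id (e a)) = true := by
      rw [hDF]
      have hle : (fun a => Sum.elim (cliqueVec Z) id (e a)) ≤
          (fun a => Sum.elim (fun _ : KEdge m => true) id (e a)) := by
        intro a
        show Sum.elim (cliqueVec Z) id (e a) ≤ Sum.elim (fun _ : KEdge m => true) id (e a)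
        cases e a with
        | inl v => exact Bool.le_true _
        | inr b => exact le_rfl
      have h2 : decide (SuppFn (NN n) (Finset.univ.filter fun a : σ n =>
            Sum.elim (cliqueVec Z) id (e a) = true)) ≤
          decide (SuppFn (NN n) (Finset.univ.filter fun a : σ n =>
            Sum.elim (fun _ : KEdge m => true) id (e a) = true)) := hFmono hle
      rw [hacc Z hZ] at h2
      exact Bool.eq_true_of_true_le h2
    have hbot : D.eval (fun a => Sum.elim (fun _ : KEdge m => false) id (e a)) = false := by
      rw [hDF]
      have hle : (fun a => Sum.elim (fun _ : KEdge m => false) id (e a)) ≤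
          (fun a => Sum.elim (colorVec O) id (e a)) := by
        intro a
        show Sum.elim (fun _ : KEdge m => false) id (e a) ≤ Sum.elim (colorVec O) id (e a)
        cases e a with
        | inl v => exact Bool.false_le _
        | inr b => exact le_rfl
      have h2 : decide (SuppFn (NN n) (Finset.univ.filter fun a : σ n =>
            Sum.elim (fun _ : KEdge m => false) id (e a) = true)) ≤
          decide (SuppFn (NN n) (Finset.univ.filter fun a : σ n =>
            Sum.elim (colorVec O) id (e a) = true)) := hFmono hle
      rw [hrej O] at h2
      exact Bool.eq_false_of_le_false h2
    obtain ⟨D', hD'B, hD's, hD'ev⟩ := exists_monotoneCircuit_projection D hDB e htop hbot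
    have hD'F : D'.Computes (fun y : KEdge m → Bool => F (fun a => Sum.elim y id (e a))) := by
      intro y
      rw [hD'ev y, hDF]
    have hbound := hM₀ m hmM₀ (fun y : KEdge m → Bool => F (fun a => Sum.elim y id (e a)))
      (fun Z' hZ' => hacc Z' hZ') (fun O' => hrej O') D' hD'B hD'F
    have hcard := card_KEdge_le m
    have hreal : ((2 ^ (2 ^ q - 1) + 2 * m ^ 2 : ℕ) : ℝ) < ((D.size + 2 * m ^ 2 : ℕ) : ℝ) := by
      calc ((2 ^ (2 ^ q - 1) + 2 * m ^ 2 : ℕ) : ℝ)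
          < ((2 ^ (2 ^ q) : ℕ) : ℝ) := by exact_mod_cast hlt2
        _ ≤ (2 : ℝ) ^ ((m : ℝ) ^ (1 / 8 : ℝ)) := hreal2
        _ ≤ (D'.size : ℝ) := hbound
        _ ≤ ((D.size + 2 * m ^ 2 : ℕ) : ℝ) := by
            exact_mod_cast hD's.trans (by omega)
    have hnat : 2 ^ (2 ^ q - 1) + 2 * m ^ 2 < D.size + 2 * m ^ 2 := by
      exact_mod_cast hreal
    omega
  have hS : 2 ^ (2 ^ q - 1) + 1 ≤ circuitSizeOver monotoneBasis F :=
    le_circuitSizeOver_of_forall (exists_monotoneCircuit_nfpm n (by omega)) hall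
  -- the logarithm of the size, and the rate
  have hlog : 2 ^ q - 1 ≤ Nat.log 2 (circuitSizeOver monotoneBasis F) :=
    Nat.le_log_of_pow_le (by norm_num) (by omega)
  have hq8 : 8 ≤ q := by
    have hL64 : 64 ≤ Nat.log 2 m := Nat.le_log_of_pow_le (by norm_num) hm64
    omega
  have hmlt : m < 2 ^ (8 * q + 8) := by
    have hmL : m < 2 ^ (Nat.log 2 m + 1) := Nat.lt_pow_succ_log_self (by norm_num) m
    exact lt_of_lt_of_le hmL (Nat.pow_le_pow_right (by norm_num) (by omega))
  have hone : 1 ≤ 2 ^ q := Nat.one_le_two_pow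
  exact rate_of_log_ge hq8 (by omega) hmlt hnm

/-- ★ **Nest-free perfect-matching existence needs monotone circuits of EXPONENTIAL size.**  For all
large `n`, `n ≤ (log₂ s)^208` where `s = circuitSizeOver monotoneBasis` of the Boolean function "the
arc set `{a | x a}` of `[2n]` contains a nest-free perfect matching" (shuffle-square recognition on
ordered graphs): every `{∧₂, ∨₂}`-circuit for it has `≥ 2^{n^{1/208}}` gates
(`circuitSizeOver_expLowerBound_of_cliqueProjection` at the tree's gadget `nfpm_cliqueGadget`,
`n ≤ m^{13}`).  Sharpens the landed `nfpmExists_monotone_circuitSize_lowerBound` (`> 2^((log₂ n + c)^c)`).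
[cite: AlonBoppana1987, Lemma 3.14] [cite: Jukna2012, Thm. 9.26 (PDF p. 283)] -/
theorem nfpmExists_monotone_circuitSize_expLowerBound :
    ∃ n₀ : ℕ, ∀ n ≥ n₀, n ≤ (Nat.log 2 (circuitSizeOver monotoneBasis
      (fun x : σ n → Bool => decide (SuppFn (NN n) (Finset.univ.filter fun e => x e = true))))) ^
        208 :=
  circuitSizeOver_expLowerBound_of_cliqueProjection 13 nfpm_cliqueGadget

/-- The same in the `∃ r` form consumed by the division-hardness files of the line: for some `r`,
eventually `n ≤ (log₂ circuitSizeOver monotoneBasis NFPM_n)^r`. [folklore] -/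
theorem nfpmExists_monotone_circuitSize_expLowerBound' :
    ∃ r n₀ : ℕ, ∀ n ≥ n₀, n ≤ (Nat.log 2 (circuitSizeOver monotoneBasis
      (fun x : σ n → Bool => decide (SuppFn (NN n) (Finset.univ.filter fun e => x e = true))))) ^
        r :=
  ⟨208, nfpmExists_monotone_circuitSize_expLowerBound⟩

end Summit.ValiantsHypothesis.ValiantsHypothesis.Theorems.FifoMatching.NNNotVP.DivisionSplit

end
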